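import Literature.Geometry.Riemannian.HeatKernelBarrierSubsolution
import Literature.Geometry.Riemannian.DirectionalBarrierChainRule
import Literature.Geometry.Riemannian.DistSqBasepointDatumDeriv
import Literature.Geometry.Riemannian.HeatKernelTimeRegularity
import Literature.Geometry.Riemannian.RicciFlowDistanceContinuity
import Literature.Geometry.Riemannian.MetricCutoff
import Literature.Analysis.Calculus.CutoffProfileODE
import Mathlib.MeasureTheory.Integral.Lebesgue.Markov
import HarnessLib

/-!
# `H_m`-centres stay near the basepoint under a local two-sided Ricci bound
# (Bamler 2020a, Prop. 9.5; arXiv v1 Prop. 33 with Lemma 37)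

R. Bamler, *Entropy and heat kernel bounds on a Ricci flow background*, arXiv:2008.07093 (2020a),
§9: if `|Ric| ≤ K r⁻²` on the parabolic neighbourhood `P = P(x₀, t₀; α r, −r²)`, then every
`H_n`-centre `(z, t₀ − r²)` of `(x₀, t₀)` satisfies `d_{t₀−r²}(x₀, z) ≤ C(α, K) r`. The source
builds (Lemma 37) the cut-off sub-solution `u = e^{−C₀ t} φ(d_t(x₀, ·))` of the heat equation
(`□u ≤ 0` in the barrier sense, by Laplacian comparison and the distance distortion
`∂ₜ d_t ≥ −K d_t`), and then (proof of Prop. 33)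
`ν_{x₀,t₀;t₀−r²}(B(x₀, t₀ − r², c₀ r)) ≥ ∫ u dν ≥ u(x₀, t₀) ≥ c₁`, which together with the
concentration of `ν_{x₀,t₀;t₀−r²}` near its `H_n`-centres locates the centres.

This file assembles the statement `exists_edist_hCenter_le_of_ricci_bound` for the tree's compact
Ricci flows `IsRicciFlow h cov (Icc a T)` of smooth families of Riemannian metrics on closed
connected manifolds modelled on `ℝᵐ` and the conjugate heat kernel measures
`ν_{x,t;s} = heatKernelMeasure hh hR t x s`, from the landed bricks:

* the `C²` profile `Φ` in the variable `q = d²` with `−Φ′(2m + 3Kq) − 4qΦ″ ≤ λΦ`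
  (`exists_cutoff_profile_ode`), used at unit scale and rescaled parabolically
  (`exists_cutoff_profile_ode_scaled`);
* the one-ended directional datum of `d_t(x₀, ·)²` (`distSq_basepoint_directional_datum_deriv`)
  and the chain rule for directional barrier data (`directional_lower_barriers_of_antitone_comp`),
  giving the lower barrier datum of `u(y, t) = e^{−λ(t−t₁)} Φ(d_t(x₀, y)²)` with `□u ≤ 0`
  (`subsolution_lower_barriers`);
* the pairing inequality for barrier sub-solutions
  (`integral_heatKernelMeasure_le_of_directionalBarrier`): `s ↦ ∫ u(·, s) dν_{x₀,t₀;s}` is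
  dominated by its value at `s = t₁`;
* `ν_{x₀,t₀;s} → δ_{x₀}` as `s ↗ t₀` (`continuous_integral_heatKernelMeasure_left`) together with
  the distance distortion `d_s ≤ e^{K₁|s−t₀|} d_{t₀}` (`IsRicciFlow.exists_edist_le_exp_mul_edist`)
  and a raw metric cutoff (`exists_raw_cutoff`) to evaluate the limit;
* Chebyshev's inequality for `d_{t₁}(z, ·)²` against `ν_{x₀,t₀;t₁}`
  (`edist_toReal_le_of_measure_ball_of_lintegral_sq_le`), in place of the source's appeal to its
  Prop. 3.13.

Everything is proved; no definitions, no named facts.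

## References

* R. H. Bamler, *Entropy and heat kernel bounds on a Ricci flow background*, arXiv:2008.07093
  (2020), §9.1 Prop. 9.5 (arXiv v1: Prop. 33) and its proof in §9.2 via Lemma 37; §3.1
  Prop. 3.11 (concentration near `H_n`-centres). [Bamler2020Entropy]
-/

noncomputable section

open Set Filter Function MeasureTheory Measure
open scoped Manifold ContDiff Topology ENNReal NNReal

namespace Literature.Geometry.Riemannian

open Lorentzian Lorentzian.PseudoRiemannianMetric

/-! ### Parabolic rescaling of the cutoff profile -/

/-- **Parabolic rescaling of the cutoff profile** of `exists_cutoff_profile_ode`: the rate `λ₁`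
is chosen at unit scale (depending only on `m, K, q₁, q₂`), and for every `ρ = r² > 0` the
profile `Φ_ρ(q) = Φ₁(q/ρ)` is `1` on `(−∞, q₁ρ]`, `0` on `[q₂ρ, ∞)` and satisfies
`−Φ_ρ′(q)(2m + 3(K/ρ)q) − 4qΦ_ρ″(q) ≤ (λ₁/ρ) Φ_ρ(q)` for `q ≥ 0`.
[cite: Bamler2020Entropy, §9, proof of Lemma 37 (arXiv numbering), parabolic rescaling] -/
theorem exists_cutoff_profile_ode_scaled (m : ℕ) {K q₁ q₂ : ℝ} (hK : 0 ≤ K) (hq₁ : 0 < q₁)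
    (h12 : q₁ < q₂) :
    ∃ lam₁ : ℝ, 0 ≤ lam₁ ∧ ∀ ⦃ρ : ℝ⦄, 0 < ρ →
      ∃ (Φ Φ' Φ'' : ℝ → ℝ), Antitone Φ ∧ (∀ q, HasDerivAt Φ (Φ' q) q) ∧
        (∀ q, HasDerivAt Φ' (Φ'' q) q) ∧ (∀ q, q ≤ q₁ * ρ → Φ q = 1) ∧
        (∀ q, q₂ * ρ ≤ q → Φ q = 0) ∧ (∀ q, 0 ≤ Φ q) ∧ (∀ q, Φ q ≤ 1) ∧ (∀ q, Φ' q ≤ 0) ∧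
        ∀ q, 0 ≤ q →
          -Φ' q * (2 * (m : ℝ) + 3 * (K / ρ) * q) - 4 * q * Φ'' q ≤ lam₁ / ρ * Φ q := by
  obtain ⟨Φ, Φ', Φ'', lam, hlam, hanti, hd, hd', h1, h0, hnn, hle, h'le, hode⟩ :=
    exists_cutoff_profile_ode m hK hq₁ h12
  refine ⟨lam, hlam, fun ρ hρ ↦ ⟨fun q ↦ Φ (q / ρ), fun q ↦ Φ' (q / ρ) / ρ,
    fun q ↦ Φ'' (q / ρ) / ρ ^ 2, fun a b hab ↦ hanti (div_le_div_of_nonneg_right hab hρ.le),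
    fun q ↦ ?_, fun q ↦ ?_, fun q hq ↦ h1 _ ((div_le_iff₀ hρ).2 hq),
    fun q hq ↦ h0 _ ((le_div_iff₀ hρ).2 hq), fun q ↦ hnn _, fun q ↦ hle _,
    fun q ↦ div_nonpos_of_nonpos_of_nonneg (h'le _) hρ.le, fun q hq ↦ ?_⟩⟩
  · have hX : HasDerivAt (fun q : ℝ ↦ q / ρ) (1 / ρ) q := (hasDerivAt_id' q).div_const ρ
    exact ((hd (q / ρ)).comp q hX).congr_deriv (mul_one_div _ _)
  · have hX : HasDerivAt (fun q : ℝ ↦ q / ρ) (1 / ρ) q := (hasDerivAt_id' q).div_const ρ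
    exact (((hd' (q / ρ)).comp q hX).div_const ρ).congr_deriv (by field_simp)
  · have key := hode (q / ρ) (div_nonneg hq hρ.le)
    have e1 : -(Φ' (q / ρ) / ρ) * (2 * (m : ℝ) + 3 * (K / ρ) * q) - 4 * q * (Φ'' (q / ρ) / ρ ^ 2) =
        (1 / ρ) * (-Φ' (q / ρ) * (2 * (m : ℝ) + 3 * K * (q / ρ)) - 4 * (q / ρ) * Φ'' (q / ρ)) := by
      field_simp
    have e2 : lam / ρ * Φ (q / ρ) = (1 / ρ) * (lam * Φ (q / ρ)) := by ring
    rw [e1, e2]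
    exact mul_le_mul_of_nonneg_left key (by positivity)

/-! ### Chebyshev: locating a point from the mass of a ball and a second moment -/

section Chebyshev

variable {m : ℕ} {M : Type*} [TopologicalSpace M] [ChartedSpace (EuclideanSpace ℝ (Fin m)) M]
  [IsManifold 𝓘(ℝ, EuclideanSpace ℝ (Fin m)) ∞ M] [T3Space M]
  [MeasurableSpace M] [BorelSpace M]

/-- **Chebyshev's inequality locates a centre** (Bamler 2020a, §3.1, Prop. 3.11:
`ν(B(z, √(A H τ))) ≥ 1 − 1/A` from `Var(δ_z, ν) ≤ Hτ`): if `ν(B(x₀, ρ₀)) ≥ μ₀` and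
`∫ d(z, ·)² dν ≤ c` with `0 < c`, `0 ≤ R`, `2c ≤ R² μ₀`, then `d(x₀, z) ≤ ρ₀ + R` — the ball
`B(x₀, ρ₀)` cannot lie inside `{d(z, ·) ≥ R}`, whose mass is at most `c/R² ≤ μ₀/2`.
[cite: Bamler2020Entropy, §3.1, Prop. 3.11] -/
theorem edist_toReal_le_of_measure_ball_of_lintegral_sq_le
    (g : PseudoRiemannianMetric 𝓘(ℝ, EuclideanSpace ℝ (Fin m)) ∞ (EuclideanSpace ℝ (Fin m))
      (TangentSpace 𝓘(ℝ, EuclideanSpace ℝ (Fin m)) : M → Type _)) (hg : g.IsRiemannian)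
    (ν : Measure M) {x₀ z : M} {ρ₀ μ₀ c R : ℝ} (hc : 0 < c) (hR : 0 ≤ R)
    (hRc : 2 * c ≤ R ^ 2 * μ₀)
    (hB : ENNReal.ofReal μ₀ ≤ ν {w | g.edist hg x₀ w < ENNReal.ofReal ρ₀})
    (hz : ∫⁻ w, g.edist hg z w ^ 2 ∂ν ≤ ENNReal.ofReal c) :
    (g.edist hg x₀ z).toReal ≤ ρ₀ + R := by
  -- Markov for `d(z, ·)²` at level `R²`
  have hmeas : AEMeasurable (fun w ↦ g.edist hg z w ^ 2) ν :=
    (((ENNReal.continuous_pow 2).comp ((PseudoRiemannianMetric.continuous_edist hg).comp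
      (continuous_const.prodMk continuous_id))).measurable).aemeasurable
  have hmarkov := mul_meas_ge_le_lintegral₀ (μ := ν) hmeas (ENNReal.ofReal (R ^ 2))
  -- the ball is not contained in `{R ≤ d(z, ·)}`
  have hnot : ¬ ({w | g.edist hg x₀ w < ENNReal.ofReal ρ₀} ⊆
      {w | ENNReal.ofReal (R ^ 2) ≤ g.edist hg z w ^ 2}) := by
    intro hsub
    have h1 : ENNReal.ofReal (R ^ 2) * ENNReal.ofReal μ₀ ≤ ENNReal.ofReal c :=
      calc ENNReal.ofReal (R ^ 2) * ENNReal.ofReal μ₀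
          ≤ ENNReal.ofReal (R ^ 2) * ν {w | g.edist hg x₀ w < ENNReal.ofReal ρ₀} := by gcongr
        _ ≤ ENNReal.ofReal (R ^ 2) * ν {w | ENNReal.ofReal (R ^ 2) ≤ g.edist hg z w ^ 2} := by
            gcongr
        _ ≤ ENNReal.ofReal c := hmarkov.trans hz
    rw [← ENNReal.ofReal_mul (sq_nonneg R), ENNReal.ofReal_le_ofReal_iff hc.le] at h1
    linarith
  obtain ⟨w, hw₁, hw₂⟩ := not_subset.1 hnot
  rw [mem_setOf_eq] at hw₁ hw₂
  rw [not_le] at hw₂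
  -- `d(z, w) < R`
  have hzw : g.edist hg z w < ENNReal.ofReal R := by
    by_contra hle
    rw [not_lt] at hle
    have : ENNReal.ofReal (R ^ 2) ≤ g.edist hg z w ^ 2 := by
      rw [ENNReal.ofReal_pow hR]
      exact pow_le_pow_left' hle 2
    exact absurd hw₂ (not_lt.2 this)
  -- triangle inequality
  have htri : g.edist hg x₀ z ≤ g.edist hg x₀ w + g.edist hg w z := g.edist_triangle hg x₀ w z
  rw [g.edist_comm hg w z] at htri
  have hlt : g.edist hg x₀ z < ENNReal.ofReal ρ₀ + ENNReal.ofReal R :=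
    htri.trans_lt (ENNReal.add_lt_add hw₁ hzw)
  have hρ₀ : 0 ≤ ρ₀ := by
    by_contra hneg
    rw [not_le] at hneg
    rw [ENNReal.ofReal_of_nonpos hneg.le] at hw₁
    exact absurd hw₁ ENNReal.not_lt_zero
  rw [← ENNReal.ofReal_add hρ₀ hR] at hlt
  exact (ENNReal.toReal_lt_of_lt_ofReal hlt).le

end Chebyshev

/-! ### The lower barrier datum of `u = e^{−λ(t−t₁)} Φ(d_t(x₀, ·)²)` -/

section Barrier

variable {m : ℕ} {M : Type*} [TopologicalSpace M] [ChartedSpace (EuclideanSpace ℝ (Fin m)) M]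
  [IsManifold 𝓘(ℝ, EuclideanSpace ℝ (Fin m)) ∞ M] [T2Space M] [CompactSpace M] [ConnectedSpace M]
  {h : ℝ → PseudoRiemannianMetric 𝓘(ℝ, EuclideanSpace ℝ (Fin m)) ∞ (EuclideanSpace ℝ (Fin m))
    (TangentSpace 𝓘(ℝ, EuclideanSpace ℝ (Fin m)) : M → Type _)}
  [∀ r, (h r).HasLeviCivita]
  {cov : ℝ → CovariantDerivative 𝓘(ℝ, EuclideanSpace ℝ (Fin m)) (EuclideanSpace ℝ (Fin m))
    (TangentSpace 𝓘(ℝ, EuclideanSpace ℝ (Fin m)) : M → Type _)}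
  {a T : ℝ}

/-- **The barrier sub-solution of Bamler's Lemma 37** (arXiv numbering; Bamler 2020a, §9): for a
compact Ricci flow on `[a, T]`, a non-increasing `C²` profile `Φ` with `Φ = 1` on `(−∞, Q₁]`,
`Φ = 0` on `[Q₂, ∞)`, `Φ ≥ 0`, `Φ′ ≤ 0` and `−Φ′(q)(2m + 3K′q) − 4qΦ″(q) ≤ λΦ(q)` (`q ≥ 0`),
and `|Ric_t| ≤ K′ g_t` on the ball `{d_t(x₀, ·) < ρ}`, `Q₂ < ρ²`, the function
`u(y, t) = e^{−λ(t−t₁)} Φ(d_t(x₀, y)²)` has at every `(y, t)`, `a < t ≤ T`, for every `η > 0`, a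
datum of LOWER directional barriers in an `h(t)`-orthonormal frame with `pu − Σ bu ≤ η`, i.e.
`□u ≤ 0` in the barrier sense: where `d_t(x₀, y)² > Q₂` the zero barriers (`u ≥ 0 = u(y, t)`), at
`y = x₀` the constant barriers `e^{−λ(t−t₁)}` (`d_t(x₀, exp_{x₀}(σe)) ≤ |σ|`), and elsewhere the
chain rule `directional_lower_barriers_of_antitone_comp` applied to the one-ended datum
`distSq_basepoint_directional_datum_deriv` of `d_t(x₀, ·)²` (Laplacian comparison
`Σ b ≤ 2m + K′d²`, distance distortion `p ≥ −2K′d²`).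
[cite: Bamler2020Entropy, §9, Lemma 37 (arXiv numbering) and its proof] -/
theorem subsolution_lower_barriers (hflow : IsRicciFlow h cov (Icc a T))
    (hh : IsContMDiffFamilyOn ∞ h univ) (hR : ∀ r, (h r).IsRiemannian) {Φ Φ' Φ'' : ℝ → ℝ}
    {lam t₁ K' Q₁ Q₂ ρ : ℝ} (hanti : Antitone Φ) (hΦd : ∀ q, HasDerivAt Φ (Φ' q) q)
    (hΦ'd : ∀ q, HasDerivAt Φ' (Φ'' q) q) (hΦ1 : ∀ q, q ≤ Q₁ → Φ q = 1)
    (hΦ0 : ∀ q, Q₂ ≤ q → Φ q = 0) (hΦnn : ∀ q, 0 ≤ Φ q) (hΦ'le : ∀ q, Φ' q ≤ 0)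
    (hode : ∀ q, 0 ≤ q → -Φ' q * (2 * (m : ℝ) + 3 * K' * q) - 4 * q * Φ'' q ≤ lam * Φ q)
    (hlam : 0 ≤ lam) (hQ₁ : 0 < Q₁) (hK' : 0 ≤ K') (hρ : 0 < ρ) (hQ₂ : Q₂ < ρ ^ 2) (x₀ : M)
    {t : ℝ} (hat : a < t) (htT : t ≤ T)
    (hRic : ∀ z : M, (h t).edist (hR t) x₀ z < ENNReal.ofReal ρ →
      ∀ v : TangentSpace 𝓘(ℝ, EuclideanSpace ℝ (Fin m)) z,
        |(cov t).ricci z v v| ≤ K' * (h t).val z v v)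
    (y : M) {η : ℝ} (hη : 0 < η) :
    ∃ (e : Fin (Module.finrank ℝ (EuclideanSpace ℝ (Fin m))) →
        TangentSpace 𝓘(ℝ, EuclideanSpace ℝ (Fin m)) y)
      (U U' : Fin (Module.finrank ℝ (EuclideanSpace ℝ (Fin m))) → ℝ → ℝ)
      (bu : Fin (Module.finrank ℝ (EuclideanSpace ℝ (Fin m))) → ℝ) (Ut : ℝ → ℝ) (pu : ℝ),
      (∀ i j, (h t).val y (e i) (e j) = if i = j then 1 else 0) ∧
      (∀ i, (∀ᶠ σ in 𝓝 (0 : ℝ), HasDerivAt (U i) (U' i σ) σ) ∧ HasDerivAt (U' i) (bu i) 0 ∧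
        U i 0 = Real.exp (-lam * (t - t₁)) * Φ (((h t).edist (hR t) x₀ y).toReal ^ 2) ∧
        ∀ᶠ σ in 𝓝 (0 : ℝ), U i σ ≤ Real.exp (-lam * (t - t₁)) *
          Φ (((h t).edist (hR t) x₀ (expMap (h t).leviCivita y (σ • e i))).toReal ^ 2)) ∧
      (HasDerivWithinAt Ut pu (Iic t) t ∧
        Ut t = Real.exp (-lam * (t - t₁)) * Φ (((h t).edist (hR t) x₀ y).toReal ^ 2) ∧
        ∀ᶠ t' in 𝓝[<] t, Ut t' ≤ Real.exp (-lam * (t' - t₁)) *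
          Φ (((h t').edist (hR t') x₀ y).toReal ^ 2)) ∧
      pu - ∑ i, bu i ≤ 0 + η := by
  classical
  set g := h t with hg_def
  haveI : Fact ((1 : ℕ∞ω) ≤ (∞ : ℕ∞ω)) := ⟨by exact_mod_cast le_top⟩
  have h2 : (2 : ℕ∞ω) ≤ (∞ : ℕ∞ω) := WithTop.coe_le_coe.mpr le_top
  haveI : CovariantDerivative.ContMDiffCovariantDerivative g.leviCivita 1 :=
    contMDiffCovariantDerivative_leviCivita_of_two_le g h2
  haveI : CovariantDerivative.ContMDiffCovariantDerivative g.leviCivita ((⊤ : ℕ∞) : ℕ∞ω) :=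
    contMDiffCovariantDerivative_leviCivita_infty g le_rfl
  have hc : IsGeodesicallyComplete g.leviCivita :=
    isGeodesicallyComplete_of_compactSpace g h2 (hR t)
  -- the constant `c = e^{-λ(t-t₁)} > 0`, the distance `d = d_t(x₀, y)`
  set c : ℝ := Real.exp (-lam * (t - t₁)) with hc_def
  have hc0 : 0 < c := Real.exp_pos _
  have hu0 : ∀ (t' : ℝ) (y' : M),
      0 ≤ Real.exp (-lam * (t' - t₁)) * Φ (((h t').edist (hR t') x₀ y').toReal ^ 2) :=
    fun t' y' ↦ mul_nonneg (Real.exp_pos _).le (hΦnn _)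
  set d : ℝ := (g.edist (hR t) x₀ y).toReal with hd_def
  have hd0 : 0 ≤ d := ENNReal.toReal_nonneg
  rcases lt_or_ge Q₂ (d ^ 2) with hfar | hnear
  · -- far from `x₀`: `u(y, t) = 0` and the zero barriers
    obtain ⟨b, hb⟩ := g.exists_orthonormal_basis y (hR t)
    have hu : c * Φ (d ^ 2) = 0 := by rw [hΦ0 _ hfar.le, mul_zero]
    refine ⟨fun i ↦ b i, fun _ _ ↦ 0, fun _ _ ↦ 0, fun _ ↦ 0, fun _ ↦ 0, 0, hb,
      fun i ↦ ⟨Eventually.of_forall fun σ ↦ hasDerivAt_const σ (0 : ℝ), hasDerivAt_const _ _,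
        hu.symm, Eventually.of_forall fun σ ↦ hu0 t _⟩,
      ⟨(hasDerivAt_const t (0 : ℝ)).hasDerivWithinAt, hu.symm,
        Eventually.of_forall fun t' ↦ hu0 t' y⟩, ?_⟩
    simp only [Finset.sum_const_zero, sub_zero, zero_add]
    exact hη.le
  by_cases hne : x₀ = y
  · -- at the basepoint: `u(x₀, ·) = e^{-λ(·-t₁)}` and the constant space barriers
    subst hne
    obtain ⟨b, hb⟩ := g.exists_orthonormal_basis x₀ (hR t)
    have hdd : ∀ t', ((h t').edist (hR t') x₀ x₀).toReal ^ 2 = 0 := fun t' ↦ by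
      rw [PseudoRiemannianMetric.edist_self]; simp
    have hΦ00 : Φ 0 = 1 := hΦ1 0 hQ₁.le
    have hder : HasDerivAt (fun t' ↦ Real.exp (-lam * (t' - t₁))) (c * (-lam * 1)) t :=
      (((hasDerivAt_id t).sub_const t₁).const_mul (-lam)).exp
    refine ⟨fun i ↦ b i, fun _ _ ↦ c, fun _ _ ↦ 0, fun _ ↦ 0,
      fun t' ↦ Real.exp (-lam * (t' - t₁)), -lam * c, hb,
      fun i ↦ ⟨Eventually.of_forall fun σ ↦ hasDerivAt_const σ c, hasDerivAt_const _ _,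
        by rw [hdd t, hΦ00, mul_one], ?_⟩,
      ⟨(hder.congr_deriv (by ring)).hasDerivWithinAt, by rw [hdd t, hΦ00, mul_one],
        Eventually.of_forall fun t' ↦ by rw [hdd t', hΦ00, mul_one]⟩, ?_⟩
    · -- `c ≤ c Φ(d_t(x₀, exp_{x₀}(σ bᵢ))²)` for `σ² < Q₁`
      have hev : ∀ᶠ σ in 𝓝 (0 : ℝ), σ ^ 2 < Q₁ := by
        have h1 : Tendsto (fun σ : ℝ ↦ σ ^ 2) (𝓝 0) (𝓝 0) := by
          simpa using ((continuous_pow 2).tendsto (0 : ℝ))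
        exact h1 (Iio_mem_nhds hQ₁)
      filter_upwards [hev] with σ hσ
      have h1 := (edist_expMap_smul_toReal_le_abs g (hR t) hc x₀ (b i) (by rw [hb]; simp) σ).2
      have h3 : (g.edist (hR t) x₀ (expMap g.leviCivita x₀ (σ • b i))).toReal ^ 2 ≤ Q₁ :=
        calc (g.edist (hR t) x₀ (expMap g.leviCivita x₀ (σ • b i))).toReal ^ 2
            ≤ |σ| ^ 2 := pow_le_pow_left₀ ENNReal.toReal_nonneg h1 2
          _ = σ ^ 2 := sq_abs σ
          _ ≤ Q₁ := hσ.le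
      rw [hΦ1 _ h3, mul_one]
    · simp only [Finset.sum_const_zero, sub_zero, zero_add]
      nlinarith [mul_nonneg hlam hc0.le]
  · -- the generic point: datum of `d_t(x₀, ·)²` and the chain rule
    have hdρ : d < ρ := by
      by_contra H
      rw [not_lt] at H
      have : ρ ^ 2 ≤ d ^ 2 := pow_le_pow_left₀ hρ.le H 2
      linarith
    have hfin : g.edist (hR t) x₀ y ≠ ⊤ := PseudoRiemannianMetric.edist_ne_top (hR t) x₀ y
    have hedist : g.edist (hR t) x₀ y < ENNReal.ofReal ρ := by
      rw [← ENNReal.ofReal_toReal hfin]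
      exact (ENNReal.ofReal_lt_ofReal_iff hρ).2 hdρ
    have hRic' : ∀ z : M, g.edist (hR t) x₀ z ≤ g.edist (hR t) x₀ y →
        ∀ v : TangentSpace 𝓘(ℝ, EuclideanSpace ℝ (Fin m)) z,
          |(cov t).ricci z v v| ≤ K' * g.val z v v :=
      fun z hz v ↦ hRic z (hz.trans_lt hedist) v
    have ht : t ∈ Icc a T := ⟨hat.le, htT⟩
    have hleft : ∃ s ∈ Icc a T, s < t :=
      ⟨(a + t) / 2, ⟨by linarith, by linarith⟩, by linarith⟩
    have hΦineq : -Φ' (d ^ 2) * (2 * K' * d ^ 2 + (2 * (m : ℝ) + K' * d ^ 2)) -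
        (2 * d) ^ 2 * Φ'' (d ^ 2) ≤ lam * Φ (d ^ 2) := by
      have := hode (d ^ 2) (sq_nonneg d)
      convert this using 1
      ring
    exact directional_lower_barriers_of_antitone_comp (I := 𝓘(ℝ, EuclideanSpace ℝ (Fin m)))
      (h := h) (ψ := fun y' t' ↦ ((h t').edist (hR t') x₀ y').toReal ^ 2) (Φ := Φ) (Φ' := Φ')
      (Φ''₀ := Φ'' (d ^ 2)) (lam := lam) (t₁ := t₁) (y := y) (t := t) hanti
      (Eventually.of_forall hΦd) (hΦ'd _) (hΦ'le _) (S := 2 * (m : ℝ) + K' * d ^ 2)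
      (Pl := 2 * K' * d ^ 2) (D := d) hΦineq
      (fun η₀ hη₀ ↦ distSq_basepoint_directional_datum_deriv hh hR ordConnected_Icc hflow hne ht
        hleft hK' hRic' hη₀) η hη

end Barrier

/-! ### The location of `H_m`-centres -/

/-- **`H_m`-centres stay near the basepoint under `|Ric| ≤ K r⁻²` on a parabolic ball** (Bamler
2020a, Prop. 9.5; arXiv v1 Prop. 33): for `m ≥ 3`, `α > 0`, `K ≥ 0` there is `C = C(m, α, K) > 0`
such that for every Ricci flow `(h, cov)` on `[a, T]` of a smooth family of Riemannian metrics on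
a closed connected `m`-manifold, times `a < t₁ < t₀ ≤ T` (`r² = t₀ − t₁`), a point `x₀` with
`|Ric_t| ≤ (K/r²) g_t` on `{(y, t) : t ∈ [t₁, t₀], d_t(x₀, y) < α r}`, and every `H_m`-centre
`(z, t₁)` of `(x₀, t₀)` (`∫ d_{t₁}(z, ·)² dν_{x₀,t₀;t₁} ≤ H_m r²`, `H_m = (m − 1)π²/2 + 4`):
`d_{t₁}(x₀, z) ≤ C r`. Proof: the barrier sub-solution `u = e^{−λ(t−t₁)} Φ(d_t(x₀, ·)²)`
(`subsolution_lower_barriers`) is paired with the conjugate heat kernel measures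
(`integral_heatKernelMeasure_le_of_directionalBarrier`); letting the evaluation time tend to `t₀`
(`continuous_integral_heatKernelMeasure_left`, distance distortion and a metric cutoff) gives
`ν_{x₀,t₀;t₁}(B_{t₁}(x₀, 2αr/3)) ≥ ∫ u(·, t₁) dν_{x₀,t₀;t₁} ≥ e^{−λ₁}`, and Chebyshev's inequality
for `d_{t₁}(z, ·)²` concludes. [cite: Bamler2020Entropy, §9.1, Prop. 9.5 (arXiv v1 Prop. 33)] -/
theorem exists_edist_hCenter_le_of_ricci_bound (m : ℕ) (hm : 3 ≤ m) {α K : ℝ} (hα : 0 < α)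
    (hK : 0 ≤ K) :
    ∃ C : ℝ, 0 < C ∧ ∀ {M : Type*} [TopologicalSpace M]
      [ChartedSpace (EuclideanSpace ℝ (Fin m)) M]
      [IsManifold 𝓘(ℝ, EuclideanSpace ℝ (Fin m)) ∞ M] [T2Space M] [CompactSpace M]
      [SecondCountableTopology M] [MeasurableSpace M] [BorelSpace M] [ConnectedSpace M] [T3Space M]
      {h : ℝ → PseudoRiemannianMetric 𝓘(ℝ, EuclideanSpace ℝ (Fin m)) ∞ (EuclideanSpace ℝ (Fin m))
        (TangentSpace 𝓘(ℝ, EuclideanSpace ℝ (Fin m)) : M → Type _)}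
      {cov : ℝ → CovariantDerivative 𝓘(ℝ, EuclideanSpace ℝ (Fin m)) (EuclideanSpace ℝ (Fin m))
        (TangentSpace 𝓘(ℝ, EuclideanSpace ℝ (Fin m)) : M → Type _)}
      {a T : ℝ} (hflow : IsRicciFlow h cov (Icc a T)) (hh : IsContMDiffFamilyOn ∞ h univ)
      (hR : ∀ r, (h r).IsRiemannian),
      ∀ {t₁ t₀ : ℝ}, a < t₁ → t₁ < t₀ → t₀ ≤ T → ∀ x₀ : M,
      (∀ t ∈ Icc t₁ t₀, ∀ y : M,
        (h t).edist (hR t) x₀ y < ENNReal.ofReal (α * Real.sqrt (t₀ - t₁)) →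
        ∀ v : TangentSpace 𝓘(ℝ, EuclideanSpace ℝ (Fin m)) y,
          |(cov t).ricci y v v| ≤ K / (t₀ - t₁) * (h t).val y v v) →
      ∀ z : M,
      ∫⁻ w, (h t₁).edist (hR t₁) z w ^ 2 ∂(heatKernelMeasure hh hR t₀ x₀ t₁) ≤
        ENNReal.ofReal ((((m : ℝ) - 1) * Real.pi ^ 2 / 2 + 4) * (t₀ - t₁)) →
      ((h t₁).edist (hR t₁) x₀ z).toReal ≤ C * Real.sqrt (t₀ - t₁) := by
  -- the profile at unit scale: `q₁ = (α/3)²`, `q₂ = (2α/3)²`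
  have hq₁ : 0 < (α / 3) ^ 2 := by positivity
  have h12 : (α / 3) ^ 2 < (2 * α / 3) ^ 2 := by nlinarith
  obtain ⟨lam₁, hlam₁, hprof⟩ := exists_cutoff_profile_ode_scaled m hK hq₁ h12
  -- the constant
  set Hm : ℝ := ((m : ℝ) - 1) * Real.pi ^ 2 / 2 + 4 with hHm
  have hm1 : (1 : ℝ) ≤ m := by exact_mod_cast le_trans (by norm_num) hm
  have hHm0 : 0 < Hm := by
    have h0 : 0 ≤ ((m : ℝ) - 1) * Real.pi ^ 2 := mul_nonneg (sub_nonneg.2 hm1) (sq_nonneg _)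
    rw [hHm]
    linarith
  refine ⟨2 * α / 3 + Real.sqrt (2 * Hm * Real.exp lam₁), by positivity, ?_⟩
  intro M _ _ _ _ _ _ _ _ _ _ h cov a T hflow hh hR t₁ t₀ hat₁ h10 h0T x₀ hRic z hz
  -- the scale `τ = r²`
  set τ : ℝ := t₀ - t₁ with hτ_def
  have hτ : 0 < τ := sub_pos.2 h10
  set r : ℝ := Real.sqrt τ with hr_def
  have hr : 0 < r := Real.sqrt_pos.2 hτ
  have hr2 : r ^ 2 = τ := Real.sq_sqrt hτ.le
  -- the rescaled profile and the rate `λ = λ₁/τ`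
  obtain ⟨Φ, Φ', Φ'', hanti, hΦd, hΦ'd, hΦ1, hΦ0, hΦnn, hΦle1, hΦ'le, hode⟩ := hprof hτ
  set lam : ℝ := lam₁ / τ with hlam_def
  have hlam : 0 ≤ lam := div_nonneg hlam₁ hτ.le
  have hlamτ : lam * τ = lam₁ := div_mul_cancel₀ lam₁ hτ.ne'
  -- instances
  haveI : Fact ((1 : ℕ∞ω) ≤ (∞ : ℕ∞ω)) := ⟨by exact_mod_cast le_top⟩
  haveI : ∀ s, (h s).HasLeviCivita := fun s ↦ (h s).hasLeviCivita
  -- the test function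
  set u : M → ℝ → ℝ := fun y s ↦
    Real.exp (-lam * (s - t₁)) * Φ (((h s).edist (hR s) x₀ y).toReal ^ 2) with hu_def
  have hu0 : ∀ y s, 0 ≤ u y s := fun y s ↦ mul_nonneg (Real.exp_pos _).le (hΦnn _)
  have hu1 : ∀ y, ∀ s ∈ Icc t₁ t₀, u y s ≤ 1 := by
    intro y s hs
    have h1 : Real.exp (-lam * (s - t₁)) ≤ 1 :=
      Real.exp_le_one_iff.2 (by nlinarith [hs.1, hlam])
    calc u y s ≤ 1 * 1 := mul_le_mul h1 (hΦle1 _) (hΦnn _) zero_le_one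
      _ = 1 := one_mul _
  -- continuity of `u` on `M × [t₁, t₀]`
  have hΦc : Continuous Φ := continuous_iff_continuousAt.2 fun q ↦ (hΦd q).continuousAt
  have hdc : ContinuousOn (fun p : M × ℝ ↦ ((h p.2).edist (hR p.2) x₀ p.1).toReal)
      (univ ×ˢ Icc a T) :=
    (hflow.continuousOn_edist_toReal_family (hat₁.le.trans (h10.le.trans h0T)) hR).comp
      (continuous_const.prodMk continuous_id).continuousOn
      fun p hp ↦ ⟨mem_univ _, mem_univ _, hp.2⟩
  have huc : ∀ s₂ ∈ Icc t₁ t₀, ContinuousOn (fun p : M × ℝ ↦ u p.1 p.2) (univ ×ˢ Icc t₁ s₂) := by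
    intro s₂ hs₂
    have hsub : (univ : Set M) ×ˢ Icc t₁ s₂ ⊆ univ ×ˢ Icc a T :=
      prod_mono le_rfl (Icc_subset_Icc hat₁.le (hs₂.2.trans h0T))
    refine ContinuousOn.mul ?_ ((hΦc.comp_continuousOn ((hdc.mono hsub).pow 2)))
    exact (Real.continuous_exp.comp (continuous_const.mul
      ((continuous_snd.sub continuous_const)))).continuousOn
  -- slices of `u` are continuous
  have hus : ∀ s ∈ Icc t₁ t₀, Continuous fun y ↦ u y s := fun s hs ↦
    (huc s hs).comp_continuous (continuous_id.prodMk continuous_const)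
      fun y ↦ ⟨mem_univ _, hs.1, le_rfl⟩
  ----------------------------------------------------------------
  -- Step 1: the pairing inequality `∫ u(·, s) dν_s ≤ ∫ u(·, t₁) dν_{t₁}` for `s ∈ (t₁, t₀)`
  ----------------------------------------------------------------
  have hQ₂ : (2 * α / 3) ^ 2 * τ < (α * r) ^ 2 := by
    rw [mul_pow, hr2]; nlinarith
  have hQ₁ : 0 < (α / 3) ^ 2 * τ := by positivity
  have hK' : 0 ≤ K / τ := div_nonneg hK hτ.le
  have hpair : ∀ s ∈ Ioo t₁ t₀, ∫ y, u y s ∂(heatKernelMeasure hh hR t₀ x₀ s) ≤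
      ∫ y, u y t₁ ∂(heatKernelMeasure hh hR t₀ x₀ t₁) := by
    intro s hs
    have key := integral_heatKernelMeasure_le_of_directionalBarrier hflow hh hR (t := t₀)
      ⟨hat₁.trans h10, h0T⟩ x₀ hat₁ hs.1 hs.2 (w := u) (huc s ⟨hs.1.le, hs.2.le⟩) (c := 0)
      (fun y t ht η hη ↦ subsolution_lower_barriers hflow hh hR hanti hΦd hΦ'd hΦ1 hΦ0 hΦnn
        hΦ'le hode hlam hQ₁ hK' (mul_pos hα hr) hQ₂ x₀ (hat₁.trans ht.1)
        ((ht.2.trans hs.2.le).trans h0T) (hRic t ⟨ht.1.le, ht.2.trans hs.2.le⟩) y hη)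
    simpa only [zero_mul, add_zero] using key
  ----------------------------------------------------------------
  -- Step 2: `∫ u(·, t₁) dν_{t₁} ≥ e^{-λ₁}` (evaluation time `s ↗ t₀`)
  ----------------------------------------------------------------
  obtain ⟨K₁, hK₁, hdist⟩ := hflow.exists_edist_le_exp_mul_edist hR
  have hs₀ : 0 < α / 3 * r * Real.exp (-(K₁ * τ)) := by positivity
  obtain ⟨χ, hχc, hχ0, hχ1, hχone, hχpos, -⟩ := exists_raw_cutoff (g := h t₀) (hR t₀) x₀ hs₀
  have hχx₀ : χ x₀ = 1 :=
    hχone x₀ (by rw [PseudoRiemannianMetric.edist_self]; exact ENNReal.ofReal_pos.2 (by positivity))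
  have ht₀ : t₀ ∈ Icc a T := ⟨(hat₁.trans h10).le, h0T⟩
  -- `e^{-λ₁} χ ≤ u(·, s)` for `s ∈ [t₁, t₀]`
  have hlow : ∀ s ∈ Icc t₁ t₀, ∀ y, Real.exp (-lam₁) * χ y ≤ u y s := by
    intro s hs y
    rcases (hχ0 y).eq_or_lt with hy | hy
    · rw [← hy, mul_zero]; exact hu0 y s
    -- `d_{t₀}(x₀, y) < 3 s₀ / 4`, hence `d_s(x₀, y) < (α/3) r · (3/4)`
    have h1 := hχpos y hy
    have hsI : s ∈ Icc a T := ⟨hat₁.le.trans hs.1, hs.2.trans h0T⟩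
    have h2 := hdist t₀ ht₀ s hsI x₀ y
    have h3 : Real.exp (K₁ * |s - t₀|) ≤ Real.exp (K₁ * τ) := by
      refine Real.exp_le_exp.2 (mul_le_mul_of_nonneg_left ?_ hK₁)
      rw [abs_sub_comm, abs_of_nonneg (sub_nonneg.2 hs.2)]
      linarith [hs.1]
    have hE0 : ENNReal.ofReal (Real.exp (K₁ * τ)) ≠ 0 :=
      (ENNReal.ofReal_pos.2 (Real.exp_pos _)).ne'
    have h4 : (h s).edist (hR s) x₀ y <
        ENNReal.ofReal (Real.exp (K₁ * τ)) *
          ENNReal.ofReal (3 * (α / 3 * r * Real.exp (-(K₁ * τ))) / 4) :=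
      calc (h s).edist (hR s) x₀ y
          ≤ ENNReal.ofReal (Real.exp (K₁ * |s - t₀|)) * (h t₀).edist (hR t₀) x₀ y := h2
        _ ≤ ENNReal.ofReal (Real.exp (K₁ * τ)) * (h t₀).edist (hR t₀) x₀ y := by gcongr
        _ < ENNReal.ofReal (Real.exp (K₁ * τ)) *
              ENNReal.ofReal (3 * (α / 3 * r * Real.exp (-(K₁ * τ))) / 4) :=
            ENNReal.mul_lt_mul_right hE0 ENNReal.ofReal_ne_top h1
    rw [← ENNReal.ofReal_mul (Real.exp_pos _).le] at h4
    have h5 : Real.exp (K₁ * τ) * (3 * (α / 3 * r * Real.exp (-(K₁ * τ))) / 4) = α / 4 * r := by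
      have : Real.exp (K₁ * τ) * Real.exp (-(K₁ * τ)) = 1 := by
        rw [← Real.exp_add, add_neg_cancel, Real.exp_zero]
      linear_combination (3 * (α / 3 * r) / 4) * this
    rw [h5] at h4
    have h6 : ((h s).edist (hR s) x₀ y).toReal < α / 4 * r := ENNReal.toReal_lt_of_lt_ofReal h4
    have h7 : ((h s).edist (hR s) x₀ y).toReal ^ 2 ≤ (α / 3) ^ 2 * τ := by
      have h0 : 0 ≤ ((h s).edist (hR s) x₀ y).toReal := ENNReal.toReal_nonneg
      rw [← hr2]
      nlinarith
    have h8 : u y s = Real.exp (-lam * (s - t₁)) := by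
      simp only [hu_def, hΦ1 _ h7, mul_one]
    rw [h8]
    calc Real.exp (-lam₁) * χ y ≤ Real.exp (-lam₁) * 1 :=
          mul_le_mul_of_nonneg_left (hχ1 y) (Real.exp_pos _).le
      _ = Real.exp (-lam₁) := mul_one _
      _ ≤ Real.exp (-lam * (s - t₁)) := by
          refine Real.exp_le_exp.2 ?_
          have : lam * (s - t₁) ≤ lam * τ := mul_le_mul_of_nonneg_left (by linarith [hs.2]) hlam
          linarith
  -- the pairing inequality in the limit `s ↗ t₀`
  have hI : ∀ s ∈ Ioo t₁ t₀, Real.exp (-lam₁) * ∫ y, χ y ∂(heatKernelMeasure hh hR t₀ x₀ s) ≤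
      ∫ y, u y t₁ ∂(heatKernelMeasure hh hR t₀ x₀ t₁) := by
    intro s hs
    have hsI : s ∈ Icc t₁ t₀ := ⟨hs.1.le, hs.2.le⟩
    calc Real.exp (-lam₁) * ∫ y, χ y ∂(heatKernelMeasure hh hR t₀ x₀ s)
        = ∫ y, Real.exp (-lam₁) * χ y ∂(heatKernelMeasure hh hR t₀ x₀ s) :=
          (integral_const_mul _ _).symm
      _ ≤ ∫ y, u y s ∂(heatKernelMeasure hh hR t₀ x₀ s) :=
          integral_mono ((continuous_const.mul hχc).integrable_of_hasCompactSupport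
              (HasCompactSupport.of_compactSpace _))
            ((hus s hsI).integrable_of_hasCompactSupport (HasCompactSupport.of_compactSpace _))
            fun y ↦ hlow s hsI y
      _ ≤ ∫ y, u y t₁ ∂(heatKernelMeasure hh hR t₀ x₀ t₁) := hpair s hs
  have hlim : Real.exp (-lam₁) ≤ ∫ y, u y t₁ ∂(heatKernelMeasure hh hR t₀ x₀ t₁) := by
    have hfc := continuous_integral_heatKernelMeasure_left hh hR t₀ x₀ hχc
    have hval : ∫ y, χ y ∂(heatKernelMeasure hh hR t₀ x₀ t₀) = 1 := by
      rw [heatKernelMeasure_self, integral_dirac, hχx₀]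
    have htend : Tendsto (fun s ↦ Real.exp (-lam₁) * ∫ y, χ y ∂(heatKernelMeasure hh hR t₀ x₀ s))
        (𝓝[<] t₀) (𝓝 (Real.exp (-lam₁) * 1)) := by
      rw [← hval]
      exact ((hfc.tendsto t₀).mono_left nhdsWithin_le_nhds).const_mul _
    rw [mul_one] at htend
    refine le_of_tendsto htend ?_
    filter_upwards [Ioo_mem_nhdsLT h10] with s hs using hI s hs
  ----------------------------------------------------------------
  -- Step 3: `∫ u(·, t₁) dν_{t₁} ≤ ν_{t₁}(B_{t₁}(x₀, 2αr/3))`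
  ----------------------------------------------------------------
  set ν := heatKernelMeasure hh hR t₀ x₀ t₁ with hν_def
  set B : Set M := {w | (h t₁).edist (hR t₁) x₀ w < ENNReal.ofReal (2 * α / 3 * r)} with hB_def
  have hBm : MeasurableSet B :=
    (PseudoRiemannianMetric.isOpen_setOf_edist_lt (hR t₁) x₀ _).measurableSet
  have hup : ∫ y, u y t₁ ∂ν ≤ ν.real B := by
    rw [← integral_indicator_one hBm]
    refine integral_mono ((hus t₁ ⟨le_rfl, h10.le⟩).integrable_of_hasCompactSupport
      (HasCompactSupport.of_compactSpace _)) ((integrable_const (1 : ℝ)).indicator hBm) fun y ↦ ?_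
    by_cases hy : y ∈ B
    · rw [indicator_of_mem hy, Pi.one_apply]
      exact hu1 y t₁ ⟨le_rfl, h10.le⟩
    · rw [indicator_of_notMem hy]
      have hge : ENNReal.ofReal (2 * α / 3 * r) ≤ (h t₁).edist (hR t₁) x₀ y := not_lt.1 hy
      have h1 : 2 * α / 3 * r ≤ ((h t₁).edist (hR t₁) x₀ y).toReal :=
        (ENNReal.ofReal_le_iff_le_toReal (PseudoRiemannianMetric.edist_ne_top (hR t₁) x₀ y)).1
          hge
      have h2 : (2 * α / 3) ^ 2 * τ ≤ ((h t₁).edist (hR t₁) x₀ y).toReal ^ 2 := by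
        rw [← hr2, ← mul_pow]
        exact pow_le_pow_left₀ (by positivity) h1 2
      have h3 : u y t₁ = 0 := by
        simp only [hu_def, hΦ0 _ h2, mul_zero]
      rw [h3]
  ----------------------------------------------------------------
  -- Step 4: Chebyshev
  ----------------------------------------------------------------
  have hBν : ENNReal.ofReal (Real.exp (-lam₁)) ≤ ν B :=
    ENNReal.ofReal_le_of_le_toReal (hlim.trans hup)
  have hRc : 2 * (Hm * τ) ≤ (Real.sqrt (2 * Hm * Real.exp lam₁) * r) ^ 2 * Real.exp (-lam₁) := by
    rw [mul_pow, Real.sq_sqrt (by positivity), hr2]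
    have h1 : Real.exp lam₁ * Real.exp (-lam₁) = 1 := by
      rw [← Real.exp_add, add_neg_cancel, Real.exp_zero]
    have h2 : 2 * Hm * Real.exp lam₁ * τ * Real.exp (-lam₁) = 2 * (Hm * τ) := by
      linear_combination (2 * Hm * τ) * h1
    rw [h2]
  have key := edist_toReal_le_of_measure_ball_of_lintegral_sq_le (h t₁) (hR t₁) ν
    (mul_pos hHm0 hτ) (by positivity) hRc hBν hz
  calc ((h t₁).edist (hR t₁) x₀ z).toReal
      ≤ 2 * α / 3 * r + Real.sqrt (2 * Hm * Real.exp lam₁) * r := key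
    _ = (2 * α / 3 + Real.sqrt (2 * Hm * Real.exp lam₁)) * r := by ring

end Literature.Geometry.Riemannian

end
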